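/-
Literature/AlgebraicGeometry/Pohlmann1968/MixedDifferenceCubeAbelianKernels.lean — pub-hodgecm2 (COR-CM), KEPT Literature lane
lit-deligne-3 gen 67, files F67b (§1–§2) and F67c (§3 append).  THEOREMS ONLY (no `def`, no named fact, no `sorry`, no instance, no notation; D-0026 net debt 0).
HC_CM is NOT proved.
-/
import Literature.AlgebraicGeometry.Pohlmann1968.MixedDifferenceCubeHodgeClasses
import Literature.AlgebraicGeometry.Pohlmann1968.DegenerateCMTypesAbelianCMFieldMixedDifferencesSubfields
import Literature.NumberTheory.ComplexMultiplication.CMGaloisSubfield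
import Literature.NumberTheory.ComplexMultiplication.DegenerateCMTypesAbelianKernelsIndexTwoPowerOdd
import Literature.AlgebraicGeometry.Pohlmann1968.DegenerateCMTypesAbelianCMFieldRankFormula
import HarnessLib

/-!
# The coset cubes of an admissible kernel: for an abelian CM field, the characters of kernel `Gal(K/F)` vanish on the
# type iff every mixed-difference cube over `F` along automorphisms of the prime orders is a Hodge class on `A` itself

Topic `Literature/AlgebraicGeometry/Pohlmann1968` (namespace `Literature.AlgebraicGeometry.Pohlmann1968.MixedDifferenceCube`); cell
`pub-hodgecm2` (COR-CM), KEPT Literature lane `lit-deligne-3` gen 67, file F67b — the ABELIAN-FIELD READING of F67a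
(`MixedDifferenceCubeHodgeClasses`).  KERNEL ONLY.  HC_CM is NOT proved here or anywhere in the lane.

## Mathematics

F67a: for a CM field `K ⊇ F`, commuting automorphisms `σ_i` (`i ∈ ι ≠ ∅`) of `F`, complex conjugation `c` of `F` and a base
embedding `y`, the cube `S(y) = {φ : φ|_F ∈ {(−1)^{|ε|} = 1 ? y∘σ_ε : ȳ∘σ_ε}}` is Pohlmann-balanced iff
`Σ_ε (−1)^{|ε|} #{φ ∈ Φ : φ|_F = x∘σ_ε} = 0` for all `x ∈ Hom(F, ℂ)` (granted `ε ↦ b_ε` injective).  Here: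

(1) (`forall_alternatingSum_iff_forall_isGaloisBalanced`, any CM `K ⊇ F` with `Aut_ℚ(F)` commutative and `c ≠ 1`, `p_i` pairwise
distinct odd primes).  The mixed differences vanish for EVERY family `σ` with `σ_i^{p_i} = 1` iff the cube `S(y)` is balanced for every
family with `σ_i` of order EXACTLY `p_i` and every `y`: a family with some `σ_i = 1` has vanishing mixed differences for free (flip
`ε_i`), and for orders exactly `p_i` the cube is automatically injective and CONJUGATE-FREE (`σ_ε = σ_{ε'}` forces `ε = ε'` by raising
to `Π_{j ≠ i} p_j`; `σ_ε = c σ_{ε'}` would give `c^{Π p_i} = 1 = c²`, so `c = 1`).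

(2) (`forall_sum_char_eq_zero_iff_forall_isGaloisBalanced`, `K` an ABELIAN CM field, `F = K^H` not totally real, `H` of index
`2·Π p_i` with cyclic quotient).  By the lane's kernel decision F65e (`AbelianKernels.sum_char_eq_zero_iff_alternatingSum_of_index_two_mul_
squarefree_fintype`: the characters of kernel `H` vanish on the type iff the mixed differences of the COSET COUNTS vanish) and the subfield
dictionary F66a (`MixedDifferencesReading.forall_sum_card_filter_eq_zero_iff_mixed`: coset counts at `Gal(K/F)` = multiplicities of `Φ|_F`):

  **all characters of kernel `H` vanish on `Φ` (i.e. `H` is an ADMISSIBLE KERNEL of Kubota's defect, contributing `Π(p_i − 1)` to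
  `dim A + 1 − rank MT`) ⟺ every coset cube `S(y)` over `F` along automorphisms `σ_i ∈ Gal(F/ℚ)` of orders `p_i` is Pohlmann-balanced,
  i.e. spans Hodge classes of codimension `2^{k−1}[K:F]` on every abelian variety of type `(K; Φ)`** —

the degeneracy census read as HODGE CLASSES ON `A` ITSELF (Hazama 2003, Thm. 4.8 (iv)–(vi): the `p`-dominated types of the cyclic
`2pq` field carry their nondivisorial cycles in codimension `p` on `A`; Lenstra–White: a degenerate abelian-type `A` carries a
nondivisorial class itself, White 1993 Thm. 3).

(3) (`exists_exceptional_of_forall_sum_char_eq_zero`).  If moreover `Φ` is PRIMITIVE, every realisation of `(K; Φ)` carries, for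
every such family and base point, a rational `(m,m)`-class outside `Dᵐ ⊗ ℂ`, `2m = |S(y)|` (F67a `exists_exceptional`).

THE PRINT.  F. Hazama [Hazama2003CyclicCM] Prop. 3.2, Thm. 4.8 (iv)–(vi), §5 (cyclic `2pq`, `k = 1`); S. P. White
[White1993SporadicCycles] §4 Prop. 1, Thm. 3; B. B. Gordon [Gordon1999HodgeAVSurvey] 9.2.2; T. Kubota [Kubota1965] §4 Lemma 2 (the defect
as vanishing character sums).  PRESEARCH (F67a): the `k ≥ 2` cube is not in print; lane theorem with Hazama cited for the mechanism.

## Contents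

* §1 (`F` any field with commutative `Aut_ℚ(F)`): private helpers `alternatingSum_eq_zero_of_eq_one`, `prod_ite_injective`,
  `prod_ite_ne_mul_prod_ite`, `cube_injective`, `cube_conjugateFree` (`[folklore]`); public **`forall_alternatingSum_iff_forall_isGaloisBalanced`**.
* §2 (`K` abelian CM, `F` an intermediate field): **`forall_sum_char_eq_zero_iff_forall_isGaloisBalanced`**,
  **`exists_exceptional_of_forall_sum_char_eq_zero`**.
* §3 (gen 67 append; EVERY admissible kernel whose index has an odd prime factor: `[G:H] = 2^{k+1}·Πp_i^{a_i+1}`, cyclic quotient — F66j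
  `…_of_index_two_pow_mul_primePowers_fintype` in place of F65e; the cube is the SAME prime-order cube, the displacements being the prime torsion
  of the odd part): **`forall_sum_char_eq_zero_iff_forall_isGaloisBalanced_of_index_two_pow_mul_primePowers`**,
  **`exists_exceptional_of_forall_sum_char_eq_zero_of_index_two_pow_mul_primePowers`**; the sets `S(y)` are White's sporadic sets `Δ = {β = +1}`
  (`β = Π_{p∣2m}(1 − σ^{2m/p})·H`, Lemma 3 of [White1993SporadicCycles], tree `CyclicCMType.whiteSet` ∕
  `DegenerateCMTypesAbelianFieldSporadicCycles.exists_exceptional_of_oddCharacter`) read over the subfield `F = K^H` with an arbitrary family of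
  prime-order displacements and an arbitrary base embedding; what is added here is the EQUIVALENCE with the kernel condition and the indexing by `F`.
* §4 (gen 67 append): **`isNondegenerate_iff_forall_intermediateField_cubes`** — F66l's subfield criterion for nondegeneracy with the odd-part list
  read as Hodge classes (coset cubes balanced), i.e. Lenstra's theorem (White Thm. 3) with the classes named by the census.

HONEST REGISTER.  Elementary; the algebraicity of the cube classes is not touched.  The index here is `2·Π p_i` (pairwise distinct odd
primes, the squarefree-odd-part kernels of F65e) in §2 and `2^{k+1}·Πp_i^{a_i+1}` (F66j) in §3; the pure `2`-power kernels (no odd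
prime factor) are Weil type over the cyclic CM subfield `K^H` (tree `CMTypeTwoPowerCharacterWeilTypeNumberField`) and are not cubes.  HC_CM is NOT proved and not used.

## References

* [Hazama2003CyclicCM] F. Hazama, *Hodge cycles on abelian varieties with complex multiplication by cyclic CM-fields*, J. Math. Sci.
  Univ. Tokyo 10 (2003): Prop. 3.2, Thm. 4.8 (iv)–(vi), §5.
* [White1993SporadicCycles] S. P. White, *Sporadic cycles on CM abelian varieties*, Compositio Math. 88 (1993), §4 Prop. 1, Thm. 3.
* [Kubota1965] T. Kubota, *On the field extension by complex multiplication*, Trans. AMS 118 (1965), §4 Lemma 2.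
* [Gordon1999HodgeAVSurvey] B. B. Gordon, *A survey of the Hodge conjecture for abelian varieties*, 9.2.2.
* [Pohlmann1968] H. Pohlmann, Ann. of Math. 88 (1968), Thm. 1.

## Provenance

Cell `pub-hodgecm2` (COR-CM), KEPT Literature lane `lit-deligne-3` gen 67 (claim HAZAMA-COSET-CUBE-ABELIAN-KERNELS; count-neutral, own
lane), file F67b; neighbours cited by name, nothing restated: F67a `MixedDifferenceCubeHodgeClasses` (`isGaloisBalanced_iff_forall_alternatingSum`,
`exists_exceptional`), F66a `DegenerateCMTypesAbelianCMFieldMixedDifferencesSubfields` (`forall_sum_card_filter_eq_zero_iff_mixed`), F65e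
`DegenerateCMTypesAbelianKernelsIndexTwiceSquarefree` (`…_fintype`), `DegenerateCMTypesAbelianKernels` (`exists_oddChar_ker`),
`CMGaloisSubfield` (`conjGalRestrict`, `isConj_conjGalRestrict`, `isTotallyReal_iff_conjGalRestrict_eq_one`), `DegenerateCMTypesCyclicCMFieldTwoOddPrimes`
(`isCMTypeWith_galType`).  Theorems only; net Literature debt 0.
-/

noncomputable section

open CategoryTheory NumberField
open scoped IsMulCommutative

namespace Literature.AlgebraicGeometry.Pohlmann1968

namespace MixedDifferenceCube

open Literature.NumberTheory.ComplexMultiplication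
open Literature.AlgebraicGeometry.Motives (AbelianVariety CMType)
open Literature.AlgebraicGeometry.HodgeTheory
open Literature.AlgebraicGeometry.ComplexMultiplication (IsCMTypeRealisation)
open Literature.AlgebraicGeometry.VanGeemen1994 (hodgeClassSpan)
open Literature.Barriers.HodgeConjecture (divisorClassesSpan)

open scoped Classical

/-! ## §1 Families of prime orders: injective, conjugate-free cubes; the two quantifications agree -/

section Orders

variable {K : Type} [Field K] [NumberField K] {F : Type} [Field F] [Algebra ℚ F] [IsMulCommutative (F ≃ₐ[ℚ] F)]
  (j : F →+* K) {Φ : CMType K} {ι : Type} [Fintype ι]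

omit [NumberField K] in
/-- If some `σ_{i₀} = 1`, the mixed differences of ANY function of the products `σ_ε` vanish (flip `ε_{i₀}`: same product, opposite
sign). [folklore] -/
private theorem alternatingSum_eq_zero_of_eq_one (σ : ι → (F ≃ₐ[ℚ] F)) {i₀ : ι} (h1 : σ i₀ = 1) (f : (F ≃ₐ[ℚ] F) → ℤ) :
    ∑ ε : ι → Bool, (∏ i, (if ε i then (-1 : ℤ) else 1)) * f (∏ i, (if ε i then σ i else 1)) = 0 := by
  classical
  have hprod : ∀ ε : ι → Bool, (∏ i, (if Function.update ε i₀ (!ε i₀) i then σ i else 1)) = ∏ i, (if ε i then σ i else 1) := by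
    intro ε
    refine Finset.prod_congr rfl fun i _ => ?_
    by_cases hi : i = i₀
    · subst hi; rw [Function.update_self, h1]; simp
    · rw [Function.update_of_ne hi]
  have hsign : ∀ ε : ι → Bool, (∏ i, (if Function.update ε i₀ (!ε i₀) i then (-1 : ℤ) else 1)) =
      -∏ i, (if ε i then (-1 : ℤ) else 1) := by
    intro ε
    have h1' : (if Function.update ε i₀ (!ε i₀) i₀ then (-1 : ℤ) else 1) *
        ∏ i ∈ Finset.univ.erase i₀, (if Function.update ε i₀ (!ε i₀) i then (-1 : ℤ) else 1) =
        ∏ i, (if Function.update ε i₀ (!ε i₀) i then (-1 : ℤ) else 1) :=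
      Finset.mul_prod_erase Finset.univ (fun i => if Function.update ε i₀ (!ε i₀) i then (-1 : ℤ) else 1) (Finset.mem_univ i₀)
    have h2 : (if ε i₀ then (-1 : ℤ) else 1) * ∏ i ∈ Finset.univ.erase i₀, (if ε i then (-1 : ℤ) else 1) =
        ∏ i, (if ε i then (-1 : ℤ) else 1) :=
      Finset.mul_prod_erase Finset.univ (fun i => if ε i then (-1 : ℤ) else 1) (Finset.mem_univ i₀)
    have hrest : ∏ i ∈ Finset.univ.erase i₀, (if Function.update ε i₀ (!ε i₀) i then (-1 : ℤ) else 1) =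
        ∏ i ∈ Finset.univ.erase i₀, (if ε i then (-1 : ℤ) else 1) :=
      Finset.prod_congr rfl fun i hi => by rw [Function.update_of_ne (Finset.ne_of_mem_erase hi)]
    rw [← h1', ← h2, hrest, Function.update_self]
    cases ε i₀ <;> simp
  refine Finset.sum_involution (fun ε _ => Function.update ε i₀ (!ε i₀)) ?_ ?_ ?_ ?_
  · intro ε _; rw [hsign, hprod]; ring
  · intro ε _ _ h
    have := congr_fun h i₀
    rw [Function.update_self] at this
    cases h0 : ε i₀ <;> simp [h0] at this
  · intro ε _; exact Finset.mem_univ _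
  · intro ε _; ext i; by_cases hi : i = i₀
    · subst hi; simp
    · simp [hi]

omit [NumberField K] in
/-- **Independence of automorphisms of distinct prime orders**: if `orderOf σ_i = p_i` with the `p_i` pairwise distinct primes,
then `ε ↦ σ_ε = Π_{ε_i} σ_i` is injective (raise `σ_ε = σ_{ε'}` to the power `Π_{j ≠ i} p_j`). [folklore] -/
private theorem prod_ite_injective {p : ι → ℕ} (hp : ∀ i, (p i).Prime) (hinj : Function.Injective p)
    (σ : ι → (F ≃ₐ[ℚ] F)) (hσ : ∀ i, orderOf (σ i) = p i) :
    Function.Injective fun ε : ι → Bool => ∏ i, (if ε i then σ i else 1) := by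
  classical
  intro ε ε' h
  funext i₀
  by_contra hne
  -- raise to `N = Π_{j ≠ i₀} p_j`
  set N : ℕ := ∏ j ∈ Finset.univ.erase i₀, p j with hN
  have hkill : ∀ (δ : ι → Bool), (∏ i, (if δ i then σ i else 1)) ^ N = (if δ i₀ then σ i₀ else 1) ^ N := by
    intro δ
    rw [← Finset.mul_prod_erase Finset.univ (fun i => if δ i then σ i else 1) (Finset.mem_univ i₀), mul_pow,
      ← Finset.prod_pow]
    have hone : ∏ i ∈ Finset.univ.erase i₀, (if δ i then σ i else 1) ^ N = 1 := by
      refine Finset.prod_eq_one fun i hi => ?_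
      by_cases hδ : δ i
      · rw [if_pos hδ]
        have hdvd : p i ∣ N := Finset.dvd_prod_of_mem p hi
        obtain ⟨t, ht⟩ := hdvd
        rw [ht, pow_mul, ← hσ i, pow_orderOf_eq_one, one_pow]
      · rw [if_neg hδ, one_pow]
    rw [hone, mul_one]
  have hpow : (∏ i, (if ε i then σ i else 1)) ^ N = (∏ i, (if ε' i then σ i else 1)) ^ N := by
    simp only at h; rw [h]
  rw [hkill ε, hkill ε'] at hpow
  -- `σ_{i₀}^N ≠ 1`
  have hN1 : σ i₀ ^ N ≠ 1 := by
    intro h1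
    have hdvd : p i₀ ∣ N := by rw [← hσ i₀]; exact orderOf_dvd_of_pow_eq_one h1
    rw [hN] at hdvd
    obtain ⟨i, hi, hpi⟩ := (Prime.dvd_finsetProd_iff (hp i₀).prime _).1 hdvd
    have := (Nat.prime_dvd_prime_iff_eq (hp i₀) (hp i)).1 hpi
    exact Finset.ne_of_mem_erase hi (hinj this).symm
  rcases Bool.eq_false_or_eq_true (ε i₀) with h0 | h0 <;>
    rcases Bool.eq_false_or_eq_true (ε' i₀) with h0' | h0' <;> rw [h0, h0'] at hne hpow
  · exact hne rfl
  · rw [if_pos rfl, if_neg Bool.false_ne_true, one_pow] at hpow; exact hN1 hpow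
  · rw [if_neg Bool.false_ne_true, if_pos rfl, one_pow] at hpow; exact hN1 hpow.symm
  · exact hne rfl

omit [NumberField K] in
/-- **No two products differ by an element `c ≠ 1` with `c² = 1`** (complex conjugation): `σ_ε ≠ c·σ_{ε'}`, since `σ_ε σ_{ε'}⁻¹` is killed by
the odd number `Π p_i`. [folklore] -/
private theorem prod_ite_ne_mul_prod_ite {p : ι → ℕ} (hp : ∀ i, (p i).Prime) (hodd : ∀ i, p i ≠ 2)
    (σ : ι → (F ≃ₐ[ℚ] F)) (hσ : ∀ i, σ i ^ p i = 1) {c : F ≃ₐ[ℚ] F} (hc2 : c ^ 2 = 1) (hc1 : c ≠ 1)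
    (ε ε' : ι → Bool) :
    (∏ i, (if ε i then σ i else 1)) ≠ c * ∏ i, (if ε' i then σ i else 1) := by
  intro h
  set M : ℕ := ∏ i, p i with hM
  have hkill : ∀ (δ : ι → Bool), (∏ i, (if δ i then σ i else 1)) ^ M = 1 := by
    intro δ
    rw [← Finset.prod_pow]
    refine Finset.prod_eq_one fun i _ => ?_
    by_cases hδ : δ i
    · rw [if_pos hδ]
      obtain ⟨t, ht⟩ := Finset.dvd_prod_of_mem p (Finset.mem_univ i)
      rw [show M = p i * t from ht, pow_mul, hσ i, one_pow]
    · rw [if_neg hδ, one_pow]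
  have hcM : c ^ M = 1 := by
    have h' : c = (∏ i, (if ε i then σ i else 1)) * (∏ i, (if ε' i then σ i else 1))⁻¹ := by
      rw [h, mul_inv_cancel_right]
    rw [h', mul_pow, inv_pow, hkill ε, hkill ε', inv_one, mul_one]
  have hcop : Nat.Coprime M 2 := by
    rw [hM]
    exact Nat.coprime_prod_left_iff.2 fun i _ => (Nat.coprime_primes (hp i) Nat.prime_two).2 (hodd i)
  have hord : orderOf c ∣ Nat.gcd M 2 := Nat.dvd_gcd (orderOf_dvd_of_pow_eq_one hcM) (orderOf_dvd_of_pow_eq_one hc2)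
  rw [hcop.gcd_eq_one, Nat.dvd_one, orderOf_eq_one_iff] at hord
  exact hc1 hord

omit [NumberField K] in
/-- The sign `(−1)^{|ε|}` is `1` or `−1`. [folklore] -/
private theorem sign_eq_one_or' (ε : ι → Bool) :
    (∏ i, (if ε i then (-1 : ℤ) else 1)) = 1 ∨ (∏ i, (if ε i then (-1 : ℤ) else 1)) = -1 := by
  refine Finset.prod_induction _ (fun z : ℤ => z = 1 ∨ z = -1) ?_ (Or.inl rfl) ?_
  · rintro a b (rfl | rfl) (rfl | rfl) <;> simp
  · intro i _
    by_cases h : ε i <;> simp [h]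

omit [NumberField K] [IsMulCommutative (F ≃ₐ[ℚ] F)] [Fintype ι] in
/-- `(y ∘ c) ∘ P = y ∘ (c·P)` for `ℚ`-automorphisms `c, P` of `F`. [folklore] -/
private theorem comp_comp_eq_comp_mul (y : F →+* ℂ) (c P : F ≃ₐ[ℚ] F) :
    (y.comp (c : F →+* F)).comp P.toRingEquiv.toRingHom = y.comp (c * P).toRingEquiv.toRingHom :=
  RingHom.ext fun _ => rfl

omit [NumberField K] [IsMulCommutative (F ≃ₐ[ℚ] F)] [Fintype ι] in
/-- Cancelling the (injective) base embedding: `y ∘ P = y ∘ P'` forces `P = P'`. [folklore] -/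
private theorem algEquiv_eq_of_comp_eq (y : F →+* ℂ) {P P' : F ≃ₐ[ℚ] F}
    (h : y.comp P.toRingEquiv.toRingHom = y.comp P'.toRingEquiv.toRingHom) : P = P' := by
  have h' := (RingHom.cancel_left y.injective).1 h
  exact AlgEquiv.ext fun x => RingHom.congr_fun h' x

omit [NumberField K] in
/-- **The cube of a family of prime orders is injective**: for `orderOf σ_i = p_i` (pairwise distinct odd primes) and complex conjugation
`c ≠ 1` of `F`, the bases `b_ε = (−1)^{|ε|} = 1 ? y∘σ_ε : ȳ∘σ_ε` are pairwise distinct. [folklore] -/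
private theorem cube_injective {p : ι → ℕ} (hp : ∀ i, (p i).Prime) (hinj : Function.Injective p) (hodd : ∀ i, p i ≠ 2)
    (σ : ι → (F ≃ₐ[ℚ] F)) (hσ : ∀ i, orderOf (σ i) = p i) (c : F ≃ₐ[ℚ] F)
    (hc : ∀ x : F →+* ℂ, x.comp (c : F →+* F) = ComplexEmbedding.conjugate x) (hc1 : c ≠ 1) (y : F →+* ℂ) :
    Function.Injective fun ε : ι → Bool =>
      (if (∏ i, (if ε i then (-1 : ℤ) else 1)) = 1 then y else ComplexEmbedding.conjugate y).comp
        (∏ i, (if ε i then σ i else 1)).toRingEquiv.toRingHom := by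
  have hσp : ∀ i, σ i ^ p i = 1 := fun i => by rw [← hσ i]; exact pow_orderOf_eq_one (σ i)
  have hc2 : c ^ 2 = 1 := by
    apply AlgEquiv.ext; intro x
    have h1 : ∀ z : F →+* ℂ, z.comp ((c ^ 2 : F ≃ₐ[ℚ] F) : F →+* F) = z := fun z => by
      rw [pow_two]
      have : z.comp ((c * c : F ≃ₐ[ℚ] F) : F →+* F) = (z.comp (c : F →+* F)).comp (c : F →+* F) :=
        RingHom.ext fun _ => rfl
      rw [this, hc z, hc (ComplexEmbedding.conjugate z)]
      exact ComplexEmbedding.involutive_conjugate F z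
    exact y.injective (RingHom.congr_fun (h1 y) x)
  intro ε ε' h
  simp only at h
  rcases sign_eq_one_or' ε with hε | hε <;> rcases sign_eq_one_or' ε' with hε' | hε' <;>
    simp only [hε, hε', if_true, show ((-1 : ℤ) = 1) = False from by norm_num, if_false] at h
  · exact prod_ite_injective hp hinj σ hσ (algEquiv_eq_of_comp_eq y h)
  · rw [← hc y, comp_comp_eq_comp_mul] at h
    exact (prod_ite_ne_mul_prod_ite hp hodd σ hσp hc2 hc1 ε ε' (algEquiv_eq_of_comp_eq y h)).elim
  · rw [← hc y, comp_comp_eq_comp_mul] at h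
    exact (prod_ite_ne_mul_prod_ite hp hodd σ hσp hc2 hc1 ε' ε (algEquiv_eq_of_comp_eq y h).symm).elim
  · rw [← hc y, comp_comp_eq_comp_mul, comp_comp_eq_comp_mul] at h
    have h2 := algEquiv_eq_of_comp_eq y h
    exact prod_ite_injective hp hinj σ hσ (mul_left_cancel h2)

omit [NumberField K] in
/-- **The cube of a family of prime orders is conjugate-free**: no base `b_{ε'}` is the complex conjugate of a base `b_ε`
(White's condition (a) for the cube). [folklore] -/
private theorem cube_conjugateFree {p : ι → ℕ} (hp : ∀ i, (p i).Prime) (hinj : Function.Injective p) (hodd : ∀ i, p i ≠ 2)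
    (σ : ι → (F ≃ₐ[ℚ] F)) (hσ : ∀ i, orderOf (σ i) = p i) (c : F ≃ₐ[ℚ] F)
    (hc : ∀ x : F →+* ℂ, x.comp (c : F →+* F) = ComplexEmbedding.conjugate x) (hc1 : c ≠ 1) (y : F →+* ℂ)
    (ε ε' : ι → Bool) :
    (if (∏ i, (if ε' i then (-1 : ℤ) else 1)) = 1 then y else ComplexEmbedding.conjugate y).comp
        (∏ i, (if ε' i then σ i else 1)).toRingEquiv.toRingHom ≠
      ComplexEmbedding.conjugate
        ((if (∏ i, (if ε i then (-1 : ℤ) else 1)) = 1 then y else ComplexEmbedding.conjugate y).comp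
          (∏ i, (if ε i then σ i else 1)).toRingEquiv.toRingHom) := by
  have hσp : ∀ i, σ i ^ p i = 1 := fun i => by rw [← hσ i]; exact pow_orderOf_eq_one (σ i)
  have hc2 : c ^ 2 = 1 := by
    apply AlgEquiv.ext; intro x
    have h1 : ∀ z : F →+* ℂ, z.comp ((c ^ 2 : F ≃ₐ[ℚ] F) : F →+* F) = z := fun z => by
      rw [pow_two]
      have : z.comp ((c * c : F ≃ₐ[ℚ] F) : F →+* F) = (z.comp (c : F →+* F)).comp (c : F →+* F) :=
        RingHom.ext fun _ => rfl
      rw [this, hc z, hc (ComplexEmbedding.conjugate z)]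
      exact ComplexEmbedding.involutive_conjugate F z
    exact y.injective (RingHom.congr_fun (h1 y) x)
  -- `\overline{z ∘ P} = z̄ ∘ P`
  have hconjP : ∀ (z : F →+* ℂ) (P : F ≃ₐ[ℚ] F), ComplexEmbedding.conjugate (z.comp P.toRingEquiv.toRingHom) =
      (ComplexEmbedding.conjugate z).comp P.toRingEquiv.toRingHom := fun z P => RingHom.ext fun _ => rfl
  intro h
  rcases sign_eq_one_or' ε with hε | hε <;> rcases sign_eq_one_or' ε' with hε' | hε' <;>
    simp only [hε, hε', if_true, show ((-1 : ℤ) = 1) = False from by norm_num, if_false, hconjP,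
      ComplexEmbedding.involutive_conjugate F y] at h
  · -- `y σ_{ε'} = ȳ σ_ε`
    rw [← hc y, comp_comp_eq_comp_mul] at h
    exact prod_ite_ne_mul_prod_ite hp hodd σ hσp hc2 hc1 ε' ε (algEquiv_eq_of_comp_eq y h)
  · -- `ȳ σ_{ε'} = ȳ σ_ε`: `ε' = ε`, signs clash
    have h2 := prod_ite_injective hp hinj σ hσ (algEquiv_eq_of_comp_eq (ComplexEmbedding.conjugate y) h)
    rw [h2, hε] at hε'
    norm_num at hε'
  · -- `y σ_{ε'} = y σ_ε`
    have h2 := prod_ite_injective hp hinj σ hσ (algEquiv_eq_of_comp_eq y h)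
    rw [h2, hε] at hε'
    norm_num at hε'
  · -- `ȳ σ_{ε'} = y σ_ε`
    rw [← hc y, comp_comp_eq_comp_mul] at h
    exact prod_ite_ne_mul_prod_ite hp hodd σ hσp hc2 hc1 ε ε' (algEquiv_eq_of_comp_eq y h).symm

/-- **THE TWO QUANTIFICATIONS AGREE.**  For a CM field `K ⊇ F` (`j : F → K`), complex conjugation `c ≠ 1` of `F`, `ι ≠ ∅` and pairwise
distinct odd primes `p_i`: the mixed differences `Σ_ε (−1)^{|ε|} #{φ ∈ Φ : φ|_F = x∘σ_ε}` vanish for EVERY family `σ` with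
`σ_i^{p_i} = 1` and every `x` (the field-side admissible-kernel condition of the lane's census, F66a) iff for every family with
`orderOf σ_i = p_i` and every base embedding `y` the mixed-difference cube `S(y)` is Pohlmann-balanced (F67a) — families with some
`σ_i = 1` contribute nothing, and prime-order families have injective cubes. [cite: Hazama2003CyclicCM, Prop. 3.2, Thm. 4.8 (iv)–(vi), §5]
[cite: Pohlmann1968, Thm. 1] -/
theorem forall_alternatingSum_iff_forall_isGaloisBalanced [NumberField F] [Nonempty ι] {p : ι → ℕ} (hp : ∀ i, (p i).Prime)
    (hinj : Function.Injective p) (hodd : ∀ i, p i ≠ 2) (c : F ≃ₐ[ℚ] F)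
    (hc : ∀ x : F →+* ℂ, x.comp (c : F →+* F) = ComplexEmbedding.conjugate x) (hc1 : c ≠ 1) :
    (∀ σ : ι → (F ≃ₐ[ℚ] F), (∀ i, σ i ^ p i = 1) → ∀ x : F →+* ℂ,
        ∑ ε : ι → Bool, (∏ i, (if ε i then (-1 : ℤ) else 1)) *
          ({φ : K →+* ℂ | φ.comp j = x.comp (∏ i, (if ε i then σ i else 1)).toRingEquiv.toRingHom ∧ φ ∈ Φ.1}.ncard : ℤ) = 0) ↔
      ∀ σ : ι → (F ≃ₐ[ℚ] F), (∀ i, orderOf (σ i) = p i) → ∀ y : F →+* ℂ,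
        IsGaloisBalanced Φ (Finset.univ.filter fun φ : K →+* ℂ => φ.comp j ∈ Finset.univ.image fun ε : ι → Bool =>
          (if (∏ i, (if ε i then (-1 : ℤ) else 1)) = 1 then y else ComplexEmbedding.conjugate y).comp
            (∏ i, (if ε i then σ i else 1)).toRingEquiv.toRingHom) := by
  constructor
  · intro h σ hσ y
    have hσp : ∀ i, σ i ^ p i = 1 := fun i => by rw [← hσ i]; exact pow_orderOf_eq_one (σ i)
    exact (isGaloisBalanced_iff_forall_alternatingSum j σ (c : F →+* F) hc y _ (fun ε => rfl)
      (cube_injective hp hinj hodd σ hσ c hc hc1 y)).2 (h σ hσp)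
  · intro h σ hσp x
    by_cases hall : ∀ i, σ i ≠ 1
    · have hσ : ∀ i, orderOf (σ i) = p i := fun i =>
        ((Nat.dvd_prime (hp i)).1 (orderOf_dvd_of_pow_eq_one (hσp i))).resolve_left
          (fun h1 => hall i (orderOf_eq_one_iff.1 h1))
      exact (isGaloisBalanced_iff_forall_alternatingSum j σ (c : F →+* F) hc x _ (fun ε => rfl)
        (cube_injective hp hinj hodd σ hσ c hc hc1 x)).1 (h σ hσ x) x
    · push Not at hall
      obtain ⟨i₀, hi₀⟩ := hall
      exact alternatingSum_eq_zero_of_eq_one σ hi₀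
        (fun g => ({φ : K →+* ℂ | φ.comp j = x.comp g.toRingEquiv.toRingHom ∧ φ ∈ Φ.1}.ncard : ℤ))

end Orders

/-! ## §2 Abelian CM fields: admissible kernels of index `2Πp_i` and their coset cubes -/

section Abelian

variable {K : Type} [Field K] [NumberField K] [IsCMField K] [IsAbelianGalois ℚ K]

omit [IsAbelianGalois ℚ K] in
/-- `φ₀ ∘ ρ = conj ∘ φ₀`. [cite: Shimura1998, §18.2 Lemma (i)] -/
private theorem apply_conjGal_eq' (φ₀ : K →+* ℂ) (x : K) :
    φ₀ ((conjGal : K ≃ₐ[ℚ] K) x) = starRingEnd ℂ (φ₀ x) := by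
  rw [conjGal_apply, IsCMField.complexEmbedding_complexConj]

/-- **ADMISSIBLE KERNEL ⟺ COSET CUBES ARE HODGE CLASSES.**  Let `K` be an abelian CM field, `Φ` a CM type read on `Gal(K/ℚ)` through
`φ₀` (`S = {g : σ_g = φ₀ ∘ g⁻¹ ∈ Φ}`), `F ⊆ K` a subfield which is NOT totally real with `H = Gal(K/F)` of index `2·Πp_i` (`p_i`
pairwise distinct odd primes) and cyclic quotient.  Then ALL CHARACTERS OF KERNEL `H` VANISH ON `S` (so `H` contributes
`Π(p_i − 1)` to Kubota's defect `dim A + 1 − rank MT(A)`) IFF for every family `σ_i ∈ Gal(F/ℚ)` of orders `p_i` and every embedding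
`y` of `F` the coset cube `S(y)` (F67a) satisfies Pohlmann's condition, i.e. its weight line consists of Hodge classes on every
abelian variety of type `(K; Φ)` (Pohlmann's Theorem 1) — by F65e (characters ↔ mixed differences of coset counts), F66a (coset
counts ↔ multiplicities of `Φ|_F`) and §1.  Hazama's case `k = 1`, `K` cyclic of degree `2pq`: the `p`-dominated types
(`S ∈ S_p − S_1`) are exactly those whose nondivisorial cycles of codimension `p` are the coset classes `F⁻¹(w_k^{(2q)})`.
[cite: Hazama2003CyclicCM, Prop. 3.2, Thm. 4.8 (ii), (iv)–(vi), §5] [cite: Kubota1965, §4 Lemma 2] [cite: Pohlmann1968, Thm. 1] -/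
theorem forall_sum_char_eq_zero_iff_forall_isGaloisBalanced (φ₀ : K →+* ℂ) (Φ : CMType K) (F : IntermediateField ℚ K)
    [IsAbelianGalois ℚ F] (hF : ¬ IsTotallyReal F) {ι : Type} [Fintype ι] [Nonempty ι] {p : ι → ℕ}
    (hp : ∀ i, (p i).Prime) (hinj : Function.Injective p) (hodd : ∀ i, p i ≠ 2)
    (hidx : F.fixingSubgroup.index = 2 * ∏ i, p i) (hcyc : IsCyclic ((K ≃ₐ[ℚ] K) ⧸ F.fixingSubgroup)) :
    (∀ χ : AddChar (Additive (K ≃ₐ[ℚ] K)) ℂ, (∀ g : K ≃ₐ[ℚ] K, χ (Additive.ofMul g) = 1 ↔ g ∈ F.fixingSubgroup) →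
        ∑ s ∈ (Finset.univ.filter fun g : K ≃ₐ[ℚ] K => embOf φ₀ g ∈ Φ.1), χ (Additive.ofMul s) = 0) ↔
      ∀ σ : ι → (F ≃ₐ[ℚ] F), (∀ i, orderOf (σ i) = p i) → ∀ y : F →+* ℂ,
        IsGaloisBalanced Φ (Finset.univ.filter fun φ : K →+* ℂ => φ.comp (algebraMap F K) ∈
          Finset.univ.image fun ε : ι → Bool =>
            (if (∏ i, (if ε i then (-1 : ℤ) else 1)) = 1 then y else ComplexEmbedding.conjugate y).comp
              (∏ i, (if ε i then σ i else 1)).toRingEquiv.toRingHom) := by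
  haveI : NumberField F :=
    { to_charZero := inferInstance, to_finiteDimensional := inferInstance }
  have hρH : (conjGal : K ≃ₐ[ℚ] K) ∉ F.fixingSubgroup := (CMNumbers.conjGal_not_mem_fixingSubgroup_iff F).2 hF
  have hS := CyclicTwoOddPrimes.isCMTypeWith_galType (apply_conjGal_eq' φ₀) Φ
  -- characters ↔ coset mixed differences (F65e)
  have h1 : (∀ χ : AddChar (Additive (K ≃ₐ[ℚ] K)) ℂ, (∀ g : K ≃ₐ[ℚ] K, χ (Additive.ofMul g) = 1 ↔ g ∈ F.fixingSubgroup) →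
        ∑ s ∈ (Finset.univ.filter fun g : K ≃ₐ[ℚ] K => embOf φ₀ g ∈ Φ.1), χ (Additive.ofMul s) = 0) ↔
      ∀ (g : K ≃ₐ[ℚ] K) (x : ι → (K ≃ₐ[ℚ] K)), (∀ i, x i ^ p i ∈ F.fixingSubgroup) →
        ∑ ε : ι → Bool, (∏ i, (if ε i then (-1 : ℤ) else 1)) *
          (((Finset.univ.filter fun g : K ≃ₐ[ℚ] K => embOf φ₀ g ∈ Φ.1).filter
            fun s => (g * ∏ i, (if ε i then x i else 1))⁻¹ * s ∈ F.fixingSubgroup).card : ℤ) = 0 := by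
    obtain ⟨χ₀, -, hker₀⟩ := CyclicCMType.AbelianKernels.exists_oddChar_ker hρH conjGal_mul_conjGal hcyc
    constructor
    · intro h
      exact (CyclicCMType.AbelianKernels.sum_char_eq_zero_iff_alternatingSum_of_index_two_mul_squarefree_fintype
        ‹Nonempty ι› hp hinj hodd hS χ₀ hρH hker₀ hidx hcyc).1 (h χ₀ hker₀)
    · intro h χ hker
      exact (CyclicCMType.AbelianKernels.sum_char_eq_zero_iff_alternatingSum_of_index_two_mul_squarefree_fintype
        ‹Nonempty ι› hp hinj hodd hS χ hρH hker hidx hcyc).2 h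
  rw [h1, MixedDifferencesReading.forall_sum_card_filter_eq_zero_iff_mixed φ₀ Φ F p]
  -- field-side mixed differences ↔ cubes (§1), with `c` = the restriction of complex conjugation to `F`
  have hc1 : conjGalRestrict F ≠ 1 := fun h => hF ((isTotallyReal_iff_conjGalRestrict_eq_one F).2 h)
  have hc : ∀ x : F →+* ℂ, x.comp (conjGalRestrict F : F →+* F) = ComplexEmbedding.conjugate x := fun x => by
    have h := isConj_conjGalRestrict F x
    unfold ComplexEmbedding.IsConj at h
    exact h.symm
  exact forall_alternatingSum_iff_forall_isGaloisBalanced (algebraMap F K : F →+* K) (Φ := Φ) hp hinj hodd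
    (conjGalRestrict F) hc hc1

/-- **EXCEPTIONAL HODGE CLASSES FROM THE CENSUS, ON `A` ITSELF.**  Under the hypotheses of
`forall_sum_char_eq_zero_iff_forall_isGaloisBalanced`, if the characters of kernel `Gal(K/F)` vanish on the type and `Φ` is PRIMITIVE,
then for every family `σ_i ∈ Gal(F/ℚ)` of orders `p_i`, every embedding `y` of `F` and EVERY realisation `(A, ι_A, θ)` of `(K; Φ)`,
there is a rational class of Hodge type `(m, m)` on `A`, `2m = |S(y)|` (`= 2^k [K:F]`), OUTSIDE `Dᵐ(A) ⊗ ℂ`: the weight class of the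
coset cube (F67a `exists_exceptional`; the cube is injective and conjugate-free by §1).  Hazama (`k = 1`, cyclic `2pq`): the
nondivisorial cycles of codimension `p` of the `p`-dominated abelian varieties; Lenstra ∕ White: a degenerate `A` of abelian CM
type carries a nondivisorial Hodge class itself. [cite: Hazama2003CyclicCM, Thm. 4.8 (iv)–(vi) and §5, Remark 4.10]
[cite: White1993SporadicCycles, §4 Prop. 1 and Thm. 3] [cite: Gordon1999HodgeAVSurvey, 9.2.2] -/
theorem exists_exceptional_of_forall_sum_char_eq_zero (φ₀ : K →+* ℂ) (Φ : CMType K) (F : IntermediateField ℚ K)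
    [IsAbelianGalois ℚ F] (hF : ¬ IsTotallyReal F) {ι : Type} [Fintype ι] [Nonempty ι] {p : ι → ℕ}
    (hp : ∀ i, (p i).Prime) (hinj : Function.Injective p) (hodd : ∀ i, p i ≠ 2)
    (hidx : F.fixingSubgroup.index = 2 * ∏ i, p i) (hcyc : IsCyclic ((K ≃ₐ[ℚ] K) ⧸ F.fixingSubgroup))
    (hker : ∀ χ : AddChar (Additive (K ≃ₐ[ℚ] K)) ℂ, (∀ g : K ≃ₐ[ℚ] K, χ (Additive.ofMul g) = 1 ↔ g ∈ F.fixingSubgroup) →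
        ∑ s ∈ (Finset.univ.filter fun g : K ≃ₐ[ℚ] K => embOf φ₀ g ∈ Φ.1), χ (Additive.ofMul s) = 0)
    (hprim : IsPrimitive (ℂ ≃+* ℂ) Φ.1 φ₀) (σ : ι → (F ≃ₐ[ℚ] F)) (hσ : ∀ i, orderOf (σ i) = p i) (y : F →+* ℂ)
    {A : AbelianVariety ℂ} {ιA : 𝓞 K →+* End A} {θ : K →+* Module.End ℂ (complexBetti A.X 1)}
    (hA : IsCMTypeRealisation Φ A ιA θ) :
    ∃ m : ℕ, (Finset.univ.filter fun φ : K →+* ℂ => φ.comp (algebraMap F K) ∈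
          Finset.univ.image fun ε : ι → Bool =>
            (if (∏ i, (if ε i then (-1 : ℤ) else 1)) = 1 then y else ComplexEmbedding.conjugate y).comp
              (∏ i, (if ε i then σ i else 1)).toRingEquiv.toRingHom).card = 2 * m ∧
      ∃ cl : complexBetti A.X (2 * m), IsRationalClass cl ∧
        IsOfHodgeType (Module.finrank ℚ K / 2) A.X (2 * m) m m cl ∧
        cl ∉ divisorClassesSpan A.X (Module.finrank ℚ K / 2) m := by
  haveI : NumberField F :=
    { to_charZero := inferInstance, to_finiteDimensional := inferInstance }
  have hc1 : conjGalRestrict F ≠ 1 := fun h => hF ((isTotallyReal_iff_conjGalRestrict_eq_one F).2 h)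
  have hc : ∀ x : F →+* ℂ, x.comp (conjGalRestrict F : F →+* F) = ComplexEmbedding.conjugate x := fun x => by
    have h := isConj_conjGalRestrict F x
    unfold ComplexEmbedding.IsConj at h
    exact h.symm
  have hbal := (forall_sum_char_eq_zero_iff_forall_isGaloisBalanced φ₀ Φ F hF hp hinj hodd hidx hcyc).1 hker σ hσ y
  have hσp : ∀ i, σ i ^ p i = 1 := fun i => by rw [← hσ i]; exact pow_orderOf_eq_one (σ i)
  have halt := (isGaloisBalanced_iff_forall_alternatingSum (algebraMap F K : F →+* K) σ
    (conjGalRestrict F : F →+* F) hc y _ (fun ε => rfl) (cube_injective hp hinj hodd σ hσ _ hc hc1 y)).1 hbal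
  exact exists_exceptional (algebraMap F K : F →+* K) σ (conjGalRestrict F : F →+* F) hc y _ (fun ε => rfl)
    (cube_injective hp hinj hodd σ hσ _ hc hc1 y) (cube_conjugateFree hp hinj hodd σ hσ _ hc hc1 y) φ₀ hprim halt hA

/-! ## §3 (gen 67 append) Every admissible kernel with an odd prime factor: index `2^{k+1}·Πp_i^{a_i+1}` -/

/-- **ADMISSIBLE KERNEL ⟺ COSET CUBES ARE HODGE CLASSES — EVERY INDEX WITH AN ODD PRIME FACTOR.**  `K` abelian CM, `Φ` read on
`Gal(K/ℚ)` through `φ₀`, `F ⊆ K` NOT totally real with `H = Gal(K/F)` of index `2^{k+1}·Π_i p_i^{a_i+1}` (`p_i` pairwise distinct odd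
primes, `ι ≠ ∅`) and cyclic quotient: ALL characters of kernel `H` vanish on the type iff for every family `σ_i ∈ Gal(F/ℚ)` with
`orderOf σ_i = p_i` (the prime torsion of the odd part) and every embedding `y` of `F` the coset cube `S(y)` is Pohlmann-balanced — by F66j
(characters ↔ mixed differences of coset counts along displacements `x_i^{p_i} ∈ H`), F66a (coset counts ↔ multiplicities of `Φ|_F`) and §1.
§2 is the case `k = 0`, `a = 0`.  The sets `S(y)` are White's `Δ` for the generators of `G/H` (Lemma 3).
[cite: Hazama2003CyclicCM, Prop. 3.2, Thm. 4.8 (ii), (iv)–(vi), §5] [cite: Kubota1965, §4 Lemma 2]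
[cite: White1993SporadicCycles, §4 Lemma 3 and Thm. 3] [cite: Pohlmann1968, Thm. 1] -/
theorem forall_sum_char_eq_zero_iff_forall_isGaloisBalanced_of_index_two_pow_mul_primePowers (φ₀ : K →+* ℂ) (Φ : CMType K)
    (F : IntermediateField ℚ K) [IsAbelianGalois ℚ F] (hF : ¬ IsTotallyReal F) (k : ℕ) {ι : Type} [Fintype ι] [Nonempty ι]
    {p a : ι → ℕ} (hp : ∀ i, (p i).Prime) (hinj : Function.Injective p) (hodd : ∀ i, p i ≠ 2)
    (hidx : F.fixingSubgroup.index = 2 ^ (k + 1) * ∏ i, p i ^ (a i + 1)) (hcyc : IsCyclic ((K ≃ₐ[ℚ] K) ⧸ F.fixingSubgroup)) :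
    (∀ χ : AddChar (Additive (K ≃ₐ[ℚ] K)) ℂ, (∀ g : K ≃ₐ[ℚ] K, χ (Additive.ofMul g) = 1 ↔ g ∈ F.fixingSubgroup) →
        ∑ s ∈ (Finset.univ.filter fun g : K ≃ₐ[ℚ] K => embOf φ₀ g ∈ Φ.1), χ (Additive.ofMul s) = 0) ↔
      ∀ σ : ι → (F ≃ₐ[ℚ] F), (∀ i, orderOf (σ i) = p i) → ∀ y : F →+* ℂ,
        IsGaloisBalanced Φ (Finset.univ.filter fun φ : K →+* ℂ => φ.comp (algebraMap F K) ∈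
          Finset.univ.image fun ε : ι → Bool =>
            (if (∏ i, (if ε i then (-1 : ℤ) else 1)) = 1 then y else ComplexEmbedding.conjugate y).comp
              (∏ i, (if ε i then σ i else 1)).toRingEquiv.toRingHom) := by
  haveI : NumberField F :=
    { to_charZero := inferInstance, to_finiteDimensional := inferInstance }
  have hρH : (conjGal : K ≃ₐ[ℚ] K) ∉ F.fixingSubgroup := (CMNumbers.conjGal_not_mem_fixingSubgroup_iff F).2 hF
  have hS := CyclicTwoOddPrimes.isCMTypeWith_galType (apply_conjGal_eq' φ₀) Φ
  -- characters ↔ coset mixed differences along the prime torsion of the odd part (F66j)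
  have h1 : (∀ χ : AddChar (Additive (K ≃ₐ[ℚ] K)) ℂ, (∀ g : K ≃ₐ[ℚ] K, χ (Additive.ofMul g) = 1 ↔ g ∈ F.fixingSubgroup) →
        ∑ s ∈ (Finset.univ.filter fun g : K ≃ₐ[ℚ] K => embOf φ₀ g ∈ Φ.1), χ (Additive.ofMul s) = 0) ↔
      ∀ (g : K ≃ₐ[ℚ] K) (x : ι → (K ≃ₐ[ℚ] K)), (∀ i, x i ^ p i ∈ F.fixingSubgroup) →
        ∑ ε : ι → Bool, (∏ i, (if ε i then (-1 : ℤ) else 1)) *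
          (((Finset.univ.filter fun g : K ≃ₐ[ℚ] K => embOf φ₀ g ∈ Φ.1).filter
            fun s => (g * ∏ i, (if ε i then x i else 1))⁻¹ * s ∈ F.fixingSubgroup).card : ℤ) = 0 := by
    obtain ⟨χ₀, -, hker₀⟩ := CyclicCMType.AbelianKernels.exists_oddChar_ker hρH conjGal_mul_conjGal hcyc
    constructor
    · intro h
      exact (CyclicCMType.AbelianKernels.sum_char_eq_zero_iff_alternatingSum_of_index_two_pow_mul_primePowers_fintype k
        ‹Nonempty ι› hp hinj hodd hS χ₀ hρH hker₀ hidx hcyc).1 (h χ₀ hker₀)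
    · intro h χ hker
      exact (CyclicCMType.AbelianKernels.sum_char_eq_zero_iff_alternatingSum_of_index_two_pow_mul_primePowers_fintype k
        ‹Nonempty ι› hp hinj hodd hS χ hρH hker hidx hcyc).2 h
  rw [h1, MixedDifferencesReading.forall_sum_card_filter_eq_zero_iff_mixed φ₀ Φ F p]
  have hc1 : conjGalRestrict F ≠ 1 := fun h => hF ((isTotallyReal_iff_conjGalRestrict_eq_one F).2 h)
  have hc : ∀ x : F →+* ℂ, x.comp (conjGalRestrict F : F →+* F) = ComplexEmbedding.conjugate x := fun x => by
    have h := isConj_conjGalRestrict F x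
    unfold ComplexEmbedding.IsConj at h
    exact h.symm
  exact forall_alternatingSum_iff_forall_isGaloisBalanced (algebraMap F K : F →+* K) (Φ := Φ) hp hinj hodd
    (conjGalRestrict F) hc hc1

/-- **EXCEPTIONAL HODGE CLASSES ON `A` FROM EVERY ADMISSIBLE KERNEL WITH AN ODD PRIME FACTOR.**  Under the hypotheses of
`forall_sum_char_eq_zero_iff_forall_isGaloisBalanced_of_index_two_pow_mul_primePowers`, if the characters of kernel `Gal(K/F)` vanish on the
type and `Φ` is PRIMITIVE, then for every family `σ_i ∈ Gal(F/ℚ)` of orders `p_i`, every embedding `y` of `F` and EVERY realisation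
`(A, ι_A, θ)` of `(K; Φ)` there is a rational class of Hodge type `(m, m)` on `A`, `2m = |S(y)| = 2^{|ι|}[K:F]`, OUTSIDE `Dᵐ(A) ⊗ ℂ` — the
class of White's sporadic set, here indexed by the subfield, the displacements and the base (Hazama Remark 4.10: "there always exists a
nondivisorial Hodge cycle on `A` itself if `A` is degenerate").  §2 is the case `k = 0`, `a = 0`.
[cite: White1993SporadicCycles, §4 Lemma 3 and Thm. 3] [cite: Hazama2003CyclicCM, Thm. 4.8 (iv)–(vi), §5, Remark 4.10]
[cite: Gordon1999HodgeAVSurvey, 9.2.2] -/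
theorem exists_exceptional_of_forall_sum_char_eq_zero_of_index_two_pow_mul_primePowers (φ₀ : K →+* ℂ) (Φ : CMType K)
    (F : IntermediateField ℚ K) [IsAbelianGalois ℚ F] (hF : ¬ IsTotallyReal F) (k : ℕ) {ι : Type} [Fintype ι] [Nonempty ι]
    {p a : ι → ℕ} (hp : ∀ i, (p i).Prime) (hinj : Function.Injective p) (hodd : ∀ i, p i ≠ 2)
    (hidx : F.fixingSubgroup.index = 2 ^ (k + 1) * ∏ i, p i ^ (a i + 1)) (hcyc : IsCyclic ((K ≃ₐ[ℚ] K) ⧸ F.fixingSubgroup))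
    (hker : ∀ χ : AddChar (Additive (K ≃ₐ[ℚ] K)) ℂ, (∀ g : K ≃ₐ[ℚ] K, χ (Additive.ofMul g) = 1 ↔ g ∈ F.fixingSubgroup) →
        ∑ s ∈ (Finset.univ.filter fun g : K ≃ₐ[ℚ] K => embOf φ₀ g ∈ Φ.1), χ (Additive.ofMul s) = 0)
    (hprim : IsPrimitive (ℂ ≃+* ℂ) Φ.1 φ₀) (σ : ι → (F ≃ₐ[ℚ] F)) (hσ : ∀ i, orderOf (σ i) = p i) (y : F →+* ℂ)
    {A : AbelianVariety ℂ} {ιA : 𝓞 K →+* End A} {θ : K →+* Module.End ℂ (complexBetti A.X 1)}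
    (hA : IsCMTypeRealisation Φ A ιA θ) :
    ∃ m : ℕ, (Finset.univ.filter fun φ : K →+* ℂ => φ.comp (algebraMap F K) ∈
          Finset.univ.image fun ε : ι → Bool =>
            (if (∏ i, (if ε i then (-1 : ℤ) else 1)) = 1 then y else ComplexEmbedding.conjugate y).comp
              (∏ i, (if ε i then σ i else 1)).toRingEquiv.toRingHom).card = 2 * m ∧
      ∃ cl : complexBetti A.X (2 * m), IsRationalClass cl ∧
        IsOfHodgeType (Module.finrank ℚ K / 2) A.X (2 * m) m m cl ∧
        cl ∉ divisorClassesSpan A.X (Module.finrank ℚ K / 2) m := by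
  haveI : NumberField F :=
    { to_charZero := inferInstance, to_finiteDimensional := inferInstance }
  have hc1 : conjGalRestrict F ≠ 1 := fun h => hF ((isTotallyReal_iff_conjGalRestrict_eq_one F).2 h)
  have hc : ∀ x : F →+* ℂ, x.comp (conjGalRestrict F : F →+* F) = ComplexEmbedding.conjugate x := fun x => by
    have h := isConj_conjGalRestrict F x
    unfold ComplexEmbedding.IsConj at h
    exact h.symm
  have hbal := (forall_sum_char_eq_zero_iff_forall_isGaloisBalanced_of_index_two_pow_mul_primePowers φ₀ Φ F hF k hp hinj hodd
    hidx hcyc).1 hker σ hσ y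
  have halt := (isGaloisBalanced_iff_forall_alternatingSum (algebraMap F K : F →+* K) σ
    (conjGalRestrict F : F →+* F) hc y _ (fun ε => rfl) (cube_injective hp hinj hodd σ hσ _ hc hc1 y)).1 hbal
  exact exists_exceptional (algebraMap F K : F →+* K) σ (conjGalRestrict F : F →+* F) hc y _ (fun ε => rfl)
    (cube_injective hp hinj hodd σ hσ _ hc hc1 y) (cube_conjugateFree hp hinj hodd σ hσ _ hc hc1 y) φ₀ hprim halt hA

/-- **THE SQUAREFREE CASE OF §2 FROM §3** (`k = 0`, `a = 0`: index `2·Πp_i = 2^{0+1}·Πp_i^{0+1}`), recorded as a consistency check of the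
two gluings. [cite: Hazama2003CyclicCM, Thm. 4.8] [cite: Kubota1965, §4 Lemma 2] -/
theorem forall_sum_char_eq_zero_iff_forall_isGaloisBalanced_of_pow_zero (φ₀ : K →+* ℂ) (Φ : CMType K)
    (F : IntermediateField ℚ K) [IsAbelianGalois ℚ F] (hF : ¬ IsTotallyReal F) {ι : Type} [Fintype ι] [Nonempty ι]
    {p : ι → ℕ} (hp : ∀ i, (p i).Prime) (hinj : Function.Injective p) (hodd : ∀ i, p i ≠ 2)
    (hidx : F.fixingSubgroup.index = 2 * ∏ i, p i) (hcyc : IsCyclic ((K ≃ₐ[ℚ] K) ⧸ F.fixingSubgroup)) :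
    (∀ χ : AddChar (Additive (K ≃ₐ[ℚ] K)) ℂ, (∀ g : K ≃ₐ[ℚ] K, χ (Additive.ofMul g) = 1 ↔ g ∈ F.fixingSubgroup) →
        ∑ s ∈ (Finset.univ.filter fun g : K ≃ₐ[ℚ] K => embOf φ₀ g ∈ Φ.1), χ (Additive.ofMul s) = 0) ↔
      ∀ σ : ι → (F ≃ₐ[ℚ] F), (∀ i, orderOf (σ i) = p i) → ∀ y : F →+* ℂ,
        IsGaloisBalanced Φ (Finset.univ.filter fun φ : K →+* ℂ => φ.comp (algebraMap F K) ∈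
          Finset.univ.image fun ε : ι → Bool =>
            (if (∏ i, (if ε i then (-1 : ℤ) else 1)) = 1 then y else ComplexEmbedding.conjugate y).comp
              (∏ i, (if ε i then σ i else 1)).toRingEquiv.toRingHom) :=
  forall_sum_char_eq_zero_iff_forall_isGaloisBalanced_of_index_two_pow_mul_primePowers φ₀ Φ F hF 0 (a := fun _ => 0) hp hinj hodd
    (by simpa using hidx) hcyc

/-! ## §4 (gen 67 append) The census read as Hodge classes: the third subfield list of the rank criterion -/

/-- **NONDEGENERACY OF A CM TYPE OF AN ABELIAN CM FIELD, THE ODD-PART LIST READ AS HODGE CLASSES.**  For an abelian CM field `K` and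
ANY CM type `Φ` (F66l `RankFormula.isNondegenerate_iff_forall_intermediateField_finrank`): `Φ` is nondegenerate iff (i) `Φ` is of Weil
type over no imaginary quadratic subfield, (ii) for no cyclic CM subfield `F` of degree `2^j` (`2 ≤ j ≤ v₂[K:ℚ]`) is `Φ|_F` equidistributed,
and (iii) — HERE READ THROUGH §1 — for no cyclic CM subfield `F` of degree `2^j·d` (`1 ≤ j`, `1 ≠ d ∣` the odd part of `[K:ℚ]`) are ALL
the coset cubes `S_F(σ, y)` along the families `σ_q ∈ Gal(F/ℚ)` of prime orders `q ∣ d` POHLMANN-BALANCED, i.e. Hodge classes on every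
abelian variety of type `(K; Φ)`.  Contrapositive: a DEGENERATE type has a cyclic CM subfield all of whose fibres (lists (i), (ii): Weil
type over `F`) or all of whose coset cubes (list (iii)) are Hodge classes — Lenstra's theorem (White's Thm. 3) with the classes named by
the census. [cite: Kubota1965, §4 Lemma 2] [cite: Hazama2003CyclicCM, Thm. 4.8, Remark 4.10] [cite: White1993SporadicCycles, §4 Lemma 3 and Thm. 3]
[cite: Pohlmann1968, Thm. 1] -/
theorem isNondegenerate_iff_forall_intermediateField_cubes (Φ : CMType K) :
    IsNondegenerate Φ ↔
      (∀ F : IntermediateField ℚ K, Module.finrank ℚ F = 2 → ¬ IsTotallyReal F →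
        ¬ ∀ τ : F →+* ℂ, {φ : K →+* ℂ | φ.comp (algebraMap F K) = τ ∧ φ ∈ Φ.1}.ncard =
          {φ : K →+* ℂ | φ.comp (algebraMap F K) = τ ∧ φ ∉ Φ.1}.ncard) ∧
      (∀ j ∈ Finset.Icc 2 ((Module.finrank ℚ K).factorization 2), ∀ F : IntermediateField ℚ K, Module.finrank ℚ F = 2 ^ j →
        ¬ IsTotallyReal F → IsCyclic (F ≃ₐ[ℚ] F) →
        ¬ ∀ τ : F →+* ℂ, 2 * {φ : K →+* ℂ | φ.comp (algebraMap F K) = τ ∧ φ ∈ Φ.1}.ncard = Module.finrank F K) ∧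
      (∀ j ∈ Finset.Icc 1 ((Module.finrank ℚ K).factorization 2), ∀ d : ℕ, d ∣ ordCompl[2] (Module.finrank ℚ K) → d ≠ 1 →
        ∀ F : IntermediateField ℚ K, Module.finrank ℚ F = 2 ^ j * d → ¬ IsTotallyReal F → IsCyclic (F ≃ₐ[ℚ] F) → ∀ [IsAbelianGalois ℚ F],
        ¬ ∀ σ : ↥d.primeFactors → (F ≃ₐ[ℚ] F), (∀ q, orderOf (σ q) = (q : ℕ)) → ∀ y : F →+* ℂ,
          IsGaloisBalanced Φ (Finset.univ.filter fun φ : K →+* ℂ => φ.comp (algebraMap F K) ∈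
            Finset.univ.image fun ε : ↥d.primeFactors → Bool =>
              (if (∏ q, (if ε q then (-1 : ℤ) else 1)) = 1 then y else ComplexEmbedding.conjugate y).comp
                (∏ q, (if ε q then σ q else 1)).toRingEquiv.toRingHom)) := by
  rw [RankFormula.isNondegenerate_iff_forall_intermediateField_finrank Φ]
  refine and_congr Iff.rfl (and_congr Iff.rfl ?_)
  refine forall₂_congr fun j _ => forall₂_congr fun d hd => forall_congr' fun hd1 => forall₂_congr fun F _ =>
    forall₂_congr fun hF _ => forall_congr' fun _ => not_congr ?_
  haveI : NumberField F :=
    { to_charZero := inferInstance, to_finiteDimensional := inferInstance }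
  have hd0 : d ≠ 0 := by
    rintro rfl
    obtain ⟨φ₀⟩ := (inferInstance : Nonempty (K →+* ℂ))
    have h0 : ordCompl[2] (Module.finrank ℚ K) = 0 := Nat.eq_zero_of_zero_dvd hd
    exact (Nat.ordCompl_pos 2 Module.finrank_pos.ne').ne' h0
  haveI : Nonempty ↥d.primeFactors := by
    obtain ⟨q, hq⟩ := Nat.nonempty_primeFactors.2 (lt_of_le_of_ne (Nat.one_le_iff_ne_zero.2 hd0) (Ne.symm hd1))
    exact ⟨⟨q, hq⟩⟩
  have hodd2 : ¬ 2 ∣ d := fun h2 => (Nat.not_dvd_ordCompl Nat.prime_two Module.finrank_pos.ne') (h2.trans hd)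
  have hc1 : conjGalRestrict F ≠ 1 := fun h => hF ((isTotallyReal_iff_conjGalRestrict_eq_one F).2 h)
  have hc : ∀ x : F →+* ℂ, x.comp (conjGalRestrict F : F →+* F) = ComplexEmbedding.conjugate x := fun x => by
    have h := isConj_conjGalRestrict F x
    unfold ComplexEmbedding.IsConj at h
    exact h.symm
  have key := forall_alternatingSum_iff_forall_isGaloisBalanced (algebraMap F K : F →+* K) (Φ := Φ) (ι := ↥d.primeFactors)
    (p := fun q => (q : ℕ)) (fun q => Nat.prime_of_mem_primeFactors q.2) Subtype.val_injective
    (fun q h2 => hodd2 (h2 ▸ Nat.dvd_of_mem_primeFactors q.2)) (conjGalRestrict F) hc hc1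
  -- the two sides are `key` up to the (subsingleton) `Fintype`/`DecidableEq` instances on `↥d.primeFactors → Bool`
  convert key using 10

end Abelian

end MixedDifferenceCube

end Literature.AlgebraicGeometry.Pohlmann1968

end
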